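/-
Copyright (c) 2026 the pub-hodgecm-mathlib formalisation cell (harness21).  Prover seat hodgecm-mathlib-K2E3-p06 (g0), Track B «K2-LIT» ∕ h413,
ENGINE E3 unit U4 «Keys», SIGS-TABLE row #6 `sig_K2E3IrregularReducibleCaseThree` — helper 3a (the twisted Heisenberg slice).  2026-09-04.
-/
import Summits.HodgeConjecture.HodgeConjecture.Theorems.K2E3IrregularReducibleCaseThreeChiOneNeOne   -- ★ helper 2 (this seat, p855368); brings ★ helper 1, ★ B3 ∕ B4 ∕ D1 ∕ D2A ∕ DICT cone
import HarnessLib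

/-!
# K2 · E3 · U4 «Keys», row #6 `sig_K2E3IrregularReducibleCaseThree` — helper 3a «TWISTED HEISENBERG SLICE»: for a continuous `χ₁` of `E_v^×` trivial on NORMS (no hypothesis
# on `χ₁|_{F_v^×}`), the chart-annulus integral of `‖z‖⁻¹ χ₁(σ ẑ)⁻¹` equals a NON-ZERO constant times the skew-line integral `J_h = ∫_{E_v⁻} ‖1+η‖⁻¹ χ₁(σ(1+η))⁻¹ dη`
# [Keys1984 §5, §7 Thm. (1); TateThesis1967 §2.2–2.4; WeilBNT1967 VII §2]

Cell `pub/hodgecm-mathlib` (D-0151), HCML Track B «K2-LIT», crux H413 = `stmt-HodgeConjecture-24833` (lane `--supports … --as helper`), route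
HCCMUnconditional; socket `sig_K2E3IrregularReducibleCaseThree` (U4-c) of `Cruxes/H413/Lines/K2_E3_EllipticInputsSigs_U4Keys.lean` (K2E3-plan (g0), frozen bytes).
THEOREMS ONLY (0 def ∕ 0 instance ∕ 0 notation ∕ 0 sorry); ★-only imports.  Consumer: helper 3b `K2E3IrregularReducibleCaseThreeOfSkewLineIntegral` (the socket's
second conjunct `χ₁|_{F_v^×} = 1` ⟸ `J_h ≠ 0`).

THE MATHEMATICS.  In Keys' case (3) (`χ₁|_{F^×} = 1`) ★ B3 `integral_annulus_heisZ_eq_shellMass_smul_skewLineIntegral` slices the chart integral of `‖z‖⁻¹ h(z)`,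
`h(b) = χ₁(σ b̂)⁻¹`, into `V · J_h` because `h` is invariant under the `σ`-FIXED units.  For `χ₁` merely trivial on norms (`χ₁(σα · α) = 1`, the `w`-fixed characters of
[Rogawski1990, §12.2]) `h` is NOT invariant (`h(s b) = χ₁(s)⁻¹ h(b)`, `χ₁(s) = ±1`), but the TWIST `h♯(b) = χ₁(2) · h(b) · h(b + σ b)` IS (`χ₁(s)² = χ₁(s σ s) = 1`); on the Heisenberg
chart `z = y − ½ x σx` one has `z + σ z = −x σx` (★ `heisZ_add_map`), a norm up to sign, so `h(z) = χ₁(−1) χ₁(2)⁻¹ · h♯(z)` for every unit `x`; and `h♯(1+η) = h(1+η)`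
(`(1+η) + σ(1+η) = 2`).  Hence ★ B3 applied to `h♯` gives: chart-annulus integral of `‖z‖⁻¹ h(z)` `= K · J_h`, `K = χ₁(−1)χ₁(2)⁻¹ · (√‖½‖)⁻¹ · V ≠ 0`, `V` the
`ν = ‖·‖⁻¹dx`-mass of a height shell (non-zero ★ `measure_heightShell_ne_zero`, finite on a compact ball).  §1 is written for an ARBITRARY extension `D` of `χ₁(σ ·)⁻¹`
carrying the two ★ properties of the `dite` (`dite_chiInvConj_units_mul`, `dite_chiInvConj_apply_units`) as hypotheses, so that every rewrite is first order.
* §1 `norm_dite_le_one_of_conj_mul`, `sq_eq_one_of_fixed`, `hsharp_fixed_units_mul`, `apply_heisZ_eq_mul_hsharp`, `hsharp_one_add`, `measurable_hsharp`, `norm_hsharp_le_one`.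
* §2 `withDensity_heightShell_ne_zero`, `withDensity_heightShell_ne_top`.
* §3 **`exists_const_integral_annulus_heisZ_eq_mul_skewLineIntegral`** (generic `D`) and **`exists_const_integral_annulus_heisZ_dite_eq_mul_skewLineIntegral`** (the ★ `dite`):
  `∃ K ≠ 0, ∀ A > 0, ∫ 𝟙_{(A/Q², A]}(‖z‖) (‖z‖⁻¹ • h z) d(μ_R ⊗ μ_{R⁻}) = K · ∫ ‖1+η‖⁻¹ • h(1+η) dμ_{R⁻}`.
HONEST LABEL: HC_CM is proved only modulo the 7 printed citations (2 remaining named inputs: hLiu418 = `stmt-HodgeConjecture-24832`, h413 =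
`stmt-HodgeConjecture-24833`) until rung 0 closes; count-neutral analytic plumbing (no socket paid, nothing re-lettered here).

## References
* [Keys1984] D. Keys, *Principal series representations of special unitary groups over local fields*, Compositio Math. 51 (1984), §5 (Plancherel measure); §7 Thm. (1) p. 126.
* [Rogawski1990] J. D. Rogawski, *Automorphic Representations of Unitary Groups in Three Variables*, Ann. of Math. Stud. 123 (1990), §1.10 p. 9; §12.2 (3) pp. 173–174.
* [TateThesis1967] J. Tate, *Fourier analysis in number fields and Hecke's zeta-functions*, in Cassels–Fröhlich (1967), §2.2–2.4.
* [WeilBNT1967] A. Weil, *Basic Number Theory* (1967), Ch. I §2, Ch. II §5 Prop. 12, Ch. VII §2.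
-/

set_option autoImplicit false
-- the mandated namespace has the single-problem summit's repeated segment (`HodgeConjecture.HodgeConjecture`)
set_option linter.dupNamespace false

noncomputable section

open NumberField IsDedekindDomain MeasureTheory Set
open scoped Matrix NNReal ENNReal
open Literature.NumberTheory.Automorphic Literature.NumberTheory.Automorphic.UnitaryGroup Literature.NumberTheory.Automorphic.UnitaryGroup.HeisRing
open Literature.NumberTheory.GaloisRepresentations Literature.NumberTheory.GaloisRepresentations.IsNonarchimedeanLocalField
open Summit.HodgeConjecture.HodgeConjecture.Cruxes.H413
open Summit.HodgeConjecture.HodgeConjecture.Cruxes.H413.F0P3cStCharTSLocalRingNormDictionary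
open Summit.HodgeConjecture.HodgeConjecture.Cruxes.H413.F0P3cStCharTSLocalRingNormCompactness
open Summit.HodgeConjecture.HodgeConjecture.Cruxes.H413.F0P3cStCharTSKeys3ShellVanishingCM

namespace Summit.HodgeConjecture.HodgeConjecture.Cruxes.H413.K2E3IrregularReducibleCaseThreeSkewLineSlice

variable (L : Type) [Field L] [NumberField L] [IsCMField L] (v : HeightOneSpectrum (𝓞 ↥(maximalRealSubfield L)))
  (w : PlacesOver L v) (hw : IsCMField.complexConj L • w.1 = w.1)
  (hns : ∀ w' : PlacesOver L v, IsCMField.complexConj L • w'.1 = w'.1)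
  (χ₁ : (LocalRing L v)ˣ →* ℂˣ)

/-! ## §1 The twist `h♯(b) = χ₁(2) · h(b) · h(b + σ b)` of `h(b) = χ₁(σ b̂)⁻¹` for a character trivial on norms -/

section Twist

/-! Throughout §1 the extension by zero `h` is an ARBITRARY function `D : R → ℂ` with the two ★ properties `D (b₀ b) = χ₁(σ b₀)⁻¹ • D b` (★ `dite_chiInvConj_units_mul`)
and `D u = χ₁(σ u)⁻¹` on units (★ `dite_chiInvConj_apply_units`) as hypotheses, so that every rewrite is first order (the instantiation is made in §3). -/

variable (D : LocalRing L v → ℂ)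

include hns in
open scoped Classical in
/-- **`‖h b‖ ≤ 1`** for a continuous `χ₁` TRIVIAL ON NORMS (`χ₁(σα · α) = 1`; ★ helper 1's unitarity `norm_apply_eq_one_of_apply_conj_mul_eq_one`) — ★ `norm_dite_chiInvConj_le_one` without
`χ₁|_{F^×} = 1`. [cite: Rogawski1990, §12.2 p. 173] -/
theorem norm_dite_le_one_of_conj_mul (h1 : Continuous fun x => ((χ₁ x : ℂˣ) : ℂ))
    (hnorm : ∀ α : (LocalRing L v)ˣ, χ₁ (Units.map (conjLocal L (IsCMField.complexConj L) v : LocalRing L v →* LocalRing L v) α) * χ₁ α = 1) (b : LocalRing L v) :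
    ‖(fun b : LocalRing L v => if hb : IsUnit b then
        (((χ₁ (Units.map (conjLocal L (IsCMField.complexConj L) v : LocalRing L v →* LocalRing L v) hb.unit))⁻¹ : ℂˣ) : ℂ) else 0) b‖ ≤ 1 := by
  by_cases hb : IsUnit b
  · simp only [hb, dite_true]
    rw [Units.val_inv_eq_inv_val, norm_inv,
      K2E3IrregularReducibleCaseThreeJacquetScalar.norm_apply_eq_one_of_apply_conj_mul_eq_one L v hns χ₁ h1 hnorm, inv_one]
  · simp only [hb, dite_false, norm_zero]
    exact zero_le_one

/-- **`χ₁(s)² = 1` on `σ`-fixed units** for `χ₁` trivial on norms (`s · σ s = s²`). [cite: Rogawski1990, §12.2 p. 173] -/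
theorem sq_eq_one_of_fixed
    (hnorm : ∀ α : (LocalRing L v)ˣ, χ₁ (Units.map (conjLocal L (IsCMField.complexConj L) v : LocalRing L v →* LocalRing L v) α) * χ₁ α = 1)
    (s : (LocalRing L v)ˣ) (hs : (conjLocal L (IsCMField.complexConj L) v) (s : LocalRing L v) = s) : χ₁ s * χ₁ s = 1 := by
  have hσs : Units.map (conjLocal L (IsCMField.complexConj L) v : LocalRing L v →* LocalRing L v) s = s := Units.ext hs
  have := hnorm s
  rwa [hσs] at this

/-- **`h♯` is invariant under the `σ`-FIXED units**: `h♯(s b) = h♯(b)` — `h(s b) = χ₁(σ s)⁻¹ h(b)`, `s b + σ(s b) = s (b + σ b)`, and `χ₁(s)⁻² = 1` — the `hhs` binder of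
★ B3 for `h♯ = fun b => χ₁(2) · D b · D (b + σ b)`. [cite: Keys1984, §7 Thm. (1) p. 126] [cite: TateThesis1967, §2.4] -/
theorem hsharp_fixed_units_mul [Invertible (2 : LocalRing L v)]
    (hnorm : ∀ α : (LocalRing L v)ˣ, χ₁ (Units.map (conjLocal L (IsCMField.complexConj L) v : LocalRing L v →* LocalRing L v) α) * χ₁ α = 1)
    (hDmul : ∀ (b₀ : (LocalRing L v)ˣ) (b : LocalRing L v), D ((b₀ : LocalRing L v) * b) =
      (((χ₁ (Units.map (conjLocal L (IsCMField.complexConj L) v : LocalRing L v →* LocalRing L v) b₀))⁻¹ : ℂˣ) : ℂ) • D b)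
    (s : (LocalRing L v)ˣ) (hs : (conjLocal L (IsCMField.complexConj L) v) (s : LocalRing L v) = s) (b : LocalRing L v) :
    (fun b : LocalRing L v => ((χ₁ (unitOfInvertible (2 : LocalRing L v)) : ℂˣ) : ℂ) * D b * D (b + conjLocal L (IsCMField.complexConj L) v b))
        ((s : LocalRing L v) * b) =
      (fun b : LocalRing L v => ((χ₁ (unitOfInvertible (2 : LocalRing L v)) : ℂˣ) : ℂ) * D b * D (b + conjLocal L (IsCMField.complexConj L) v b)) b := by
  have hsum : (s : LocalRing L v) * b + conjLocal L (IsCMField.complexConj L) v ((s : LocalRing L v) * b) =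
      (s : LocalRing L v) * (b + conjLocal L (IsCMField.complexConj L) v b) := by rw [map_mul, hs, mul_add]
  have hσs : Units.map (conjLocal L (IsCMField.complexConj L) v : LocalRing L v →* LocalRing L v) s = s := Units.ext hs
  have hkk : (((χ₁ s)⁻¹ : ℂˣ) : ℂ) * (((χ₁ s)⁻¹ : ℂˣ) : ℂ) = 1 := by
    rw [← Units.val_mul, ← mul_inv, sq_eq_one_of_fixed L v χ₁ hnorm s hs, inv_one, Units.val_one]
  show ((χ₁ (unitOfInvertible (2 : LocalRing L v)) : ℂˣ) : ℂ) * D ((s : LocalRing L v) * b) *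
      D ((s : LocalRing L v) * b + conjLocal L (IsCMField.complexConj L) v ((s : LocalRing L v) * b)) =
    ((χ₁ (unitOfInvertible (2 : LocalRing L v)) : ℂˣ) : ℂ) * D b * D (b + conjLocal L (IsCMField.complexConj L) v b)
  rw [hsum, hDmul, hDmul, hσs, smul_eq_mul, smul_eq_mul]
  calc ((χ₁ (unitOfInvertible (2 : LocalRing L v)) : ℂˣ) : ℂ) * ((((χ₁ s)⁻¹ : ℂˣ) : ℂ) * D b) *
        ((((χ₁ s)⁻¹ : ℂˣ) : ℂ) * D (b + conjLocal L (IsCMField.complexConj L) v b))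
        = ((((χ₁ s)⁻¹ : ℂˣ) : ℂ) * (((χ₁ s)⁻¹ : ℂˣ) : ℂ)) *
          (((χ₁ (unitOfInvertible (2 : LocalRing L v)) : ℂˣ) : ℂ) * D b * D (b + conjLocal L (IsCMField.complexConj L) v b)) := by ring
    _ = ((χ₁ (unitOfInvertible (2 : LocalRing L v)) : ℂˣ) : ℂ) * D b * D (b + conjLocal L (IsCMField.complexConj L) v b) := by rw [hkk, one_mul]

/-- **On the Heisenberg chart `h = c₀ · h♯`**: for a unit `x` and a skew `y`, with `z = y − ½ x σx` one has `z + σ z = −x σx` (★ `heisZ_add_map`), where `h` takes the value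
`χ₁(−1)⁻¹` (the norm `σx · x` is killed), so `h(z) = (χ₁(−1) χ₁(2)⁻¹) · (χ₁(2) · h(z) · h(z + σ z))`. [cite: Rogawski1990, §1.10 p. 9] [cite: Keys1984, §7 Thm. (1) p. 126] -/
theorem apply_heisZ_eq_mul_hsharp [Invertible (2 : LocalRing L v)]
    (hnorm : ∀ α : (LocalRing L v)ˣ, χ₁ (Units.map (conjLocal L (IsCMField.complexConj L) v : LocalRing L v →* LocalRing L v) α) * χ₁ α = 1)
    (hDunit : ∀ u : (LocalRing L v)ˣ, D (u : LocalRing L v) =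
      (((χ₁ (Units.map (conjLocal L (IsCMField.complexConj L) v : LocalRing L v →* LocalRing L v) u))⁻¹ : ℂˣ) : ℂ))
    {x : LocalRing L v} (hx : IsUnit x) (y : ↥(HeisRing.skewPart (conjLocal L (IsCMField.complexConj L) v))) :
    D (heisZ (conjLocal L (IsCMField.complexConj L) v) x (y : LocalRing L v)) =
      ((χ₁ (-1) * (χ₁ (unitOfInvertible (2 : LocalRing L v)))⁻¹ : ℂˣ) : ℂ) *
        (((χ₁ (unitOfInvertible (2 : LocalRing L v)) : ℂˣ) : ℂ) * D (heisZ (conjLocal L (IsCMField.complexConj L) v) x (y : LocalRing L v)) *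
          D (heisZ (conjLocal L (IsCMField.complexConj L) v) x (y : LocalRing L v) +
            conjLocal L (IsCMField.complexConj L) v (heisZ (conjLocal L (IsCMField.complexConj L) v) x (y : LocalRing L v)))) := by
  have hσ := conjLocal_conjLocal_cm L v
  -- `z + σ z = −x σx`, a unit, and `h(−x σx) = χ₁(−1)⁻¹`
  have hzz : heisZ (conjLocal L (IsCMField.complexConj L) v) x (y : LocalRing L v) +
      conjLocal L (IsCMField.complexConj L) v (heisZ (conjLocal L (IsCMField.complexConj L) v) x (y : LocalRing L v)) =
        -(x * conjLocal L (IsCMField.complexConj L) v x) :=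
    heisZ_add_map (conjLocal L (IsCMField.complexConj L) v) hσ x y.2 (map_invOf_two _)
  have hux : IsUnit (-(x * conjLocal L (IsCMField.complexConj L) v x)) := (hx.mul (hx.map _)).neg
  have hunit : Units.map (conjLocal L (IsCMField.complexConj L) v : LocalRing L v →* LocalRing L v) hux.unit =
      -1 * (Units.map (conjLocal L (IsCMField.complexConj L) v : LocalRing L v →* LocalRing L v) hx.unit * hx.unit) :=
    Units.ext (by
      rw [Units.coe_map, MonoidHom.coe_coe, hux.unit_spec, Units.val_mul, Units.val_mul, Units.coe_map, MonoidHom.coe_coe, hx.unit_spec,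
        map_neg, map_mul, hσ, Units.val_neg, Units.val_one]
      ring)
  have hval : D (-(x * conjLocal L (IsCMField.complexConj L) v x)) = (((χ₁ (-1))⁻¹ : ℂˣ) : ℂ) := by
    rw [← hux.unit_spec, hDunit, hunit, map_mul, map_mul, hnorm hx.unit, mul_one]
  rw [hzz, hval, Units.val_mul, Units.val_inv_eq_inv_val, Units.val_inv_eq_inv_val]
  have h2 : ((χ₁ (unitOfInvertible (2 : LocalRing L v)) : ℂˣ) : ℂ) ≠ 0 := Units.ne_zero _
  have h1 : ((χ₁ (-1) : ℂˣ) : ℂ) ≠ 0 := Units.ne_zero _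
  field_simp

/-- **`h♯ = h` on `1 + R⁻`**: `(1 + η) + σ(1 + η) = 2` and `h(2) = χ₁(2)⁻¹`. [cite: Keys1984, §7 Thm. (1) p. 126] -/
theorem hsharp_one_add [Invertible (2 : LocalRing L v)]
    (hDunit : ∀ u : (LocalRing L v)ˣ, D (u : LocalRing L v) =
      (((χ₁ (Units.map (conjLocal L (IsCMField.complexConj L) v : LocalRing L v →* LocalRing L v) u))⁻¹ : ℂˣ) : ℂ))
    (η : ↥(HeisRing.skewPart (conjLocal L (IsCMField.complexConj L) v))) :
    (fun b : LocalRing L v => ((χ₁ (unitOfInvertible (2 : LocalRing L v)) : ℂˣ) : ℂ) * D b * D (b + conjLocal L (IsCMField.complexConj L) v b))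
        (1 + (η : LocalRing L v)) = D (1 + (η : LocalRing L v)) := by
  have hη : conjLocal L (IsCMField.complexConj L) v (η : LocalRing L v) = -(η : LocalRing L v) := (mem_skewPart_iff _ _).1 η.2
  have hsum : (1 + (η : LocalRing L v)) + conjLocal L (IsCMField.complexConj L) v (1 + (η : LocalRing L v)) =
      ((unitOfInvertible (2 : LocalRing L v) : (LocalRing L v)ˣ) : LocalRing L v) := by
    rw [map_add, map_one, hη, val_unitOfInvertible]; ring
  have hunit : Units.map (conjLocal L (IsCMField.complexConj L) v : LocalRing L v →* LocalRing L v) (unitOfInvertible (2 : LocalRing L v)) =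
      unitOfInvertible (2 : LocalRing L v) :=
    Units.ext (by rw [Units.coe_map, MonoidHom.coe_coe, val_unitOfInvertible, map_ofNat])
  show ((χ₁ (unitOfInvertible (2 : LocalRing L v)) : ℂˣ) : ℂ) * D (1 + (η : LocalRing L v)) *
      D (1 + (η : LocalRing L v) + conjLocal L (IsCMField.complexConj L) v (1 + (η : LocalRing L v))) = D (1 + (η : LocalRing L v))
  rw [hsum, hDunit, hunit, mul_comm _ (D (1 + (η : LocalRing L v))), mul_assoc, ← Units.val_mul, mul_inv_cancel, Units.val_one, mul_one]

/-- **`h♯` is measurable** when `D` is (composition with the continuous `b ↦ b + σ b`). [cite: WeilBNT1967, Ch. I §2] -/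
theorem measurable_hsharp [MeasurableSpace (LocalRing L v)] [BorelSpace (LocalRing L v)] [Invertible (2 : LocalRing L v)] (hDm : Measurable D) :
    Measurable (fun b : LocalRing L v => ((χ₁ (unitOfInvertible (2 : LocalRing L v)) : ℂˣ) : ℂ) * D b * D (b + conjLocal L (IsCMField.complexConj L) v b)) :=
  (measurable_const.mul hDm).mul (hDm.comp (measurable_id.add (continuous_conjLocal L (IsCMField.complexConj L) v).measurable))

include hns in
/-- **`‖h♯ b‖ ≤ 1`** when `‖D‖ ≤ 1` (`|χ₁(2)| = 1`, ★ helper 1's unitarity). [cite: Rogawski1990, §12.2 p. 173] -/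
theorem norm_hsharp_le_one [Invertible (2 : LocalRing L v)] (h1 : Continuous fun x => ((χ₁ x : ℂˣ) : ℂ))
    (hnorm : ∀ α : (LocalRing L v)ˣ, χ₁ (Units.map (conjLocal L (IsCMField.complexConj L) v : LocalRing L v →* LocalRing L v) α) * χ₁ α = 1)
    (hDb : ∀ b, ‖D b‖ ≤ 1) (b : LocalRing L v) :
    ‖(fun b : LocalRing L v => ((χ₁ (unitOfInvertible (2 : LocalRing L v)) : ℂˣ) : ℂ) * D b * D (b + conjLocal L (IsCMField.complexConj L) v b)) b‖ ≤ 1 := by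
  show ‖((χ₁ (unitOfInvertible (2 : LocalRing L v)) : ℂˣ) : ℂ) * D b * D (b + conjLocal L (IsCMField.complexConj L) v b)‖ ≤ 1
  rw [norm_mul, norm_mul, K2E3IrregularReducibleCaseThreeJacquetScalar.norm_apply_eq_one_of_apply_conj_mul_eq_one L v hns χ₁ h1 hnorm, one_mul]
  exact mul_le_one₀ (hDb b) (norm_nonneg _) (hDb _)

end Twist

/-! ## §2 The height-shell mass `V` of ★ B3 at the CM datum is non-zero and finite -/

section ShellMass

variable [MeasurableSpace (LocalRing L v)] [BorelSpace (LocalRing L v)] (μX : Measure (LocalRing L v)) [μX.IsAddHaarMeasure]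

include hw in
/-- **`V ≠ 0`**: the `ν = ‖·‖⁻¹ μ_R`-mass of the height shell `{B₀/Q² < ‖x‖² ≤ B₀}` is non-zero (★ `measure_heightShell_ne_zero`: the shells tile `R ∖ 0` under `x ↦ α x`,
`ν` is `α`-invariant ★ `smulInvariantMeasure_zpowers_units`, and `ν ≠ 0`). [cite: WeilBNT1967, Ch. II §5 Prop. 12] [cite: TateThesis1967, §2.4] -/
theorem withDensity_heightShell_ne_zero (α : (LocalRing L v)ˣ) (hQ : 1 < distribHaarChar (LocalRing L v) α) {B₀ : ℝ} (hB₀ : 0 < B₀) :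
    (μX.withDensity fun x => ((∏ w' : PlacesOver L v, normAbs (w'.1.adicCompletion L) (x w'))⁻¹ : ℝ≥0))
      ((fun x : LocalRing L v => ((∏ w' : PlacesOver L v, normAbs (w'.1.adicCompletion L) (x w') : ℝ≥0) : ℝ) ^ 2) ⁻¹'
        Set.Ioc (B₀ / ((distribHaarChar (LocalRing L v) α : ℝ) ^ 2)) B₀) ≠ 0 := by
  have hnm := measurable_prod_normAbs L v
  have hmul := prod_normAbs_units_mul L v
  haveI := F0P3cStCharTSModulusShellCharacterVanishing.smulInvariantMeasure_zpowers_units μX hnm hmul α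
  have hQ21 : (1 : ℝ) < (distribHaarChar (LocalRing L v) α : ℝ) ^ 2 := by
    have h1 : (1 : ℝ) < (distribHaarChar (LocalRing L v) α : ℝ) := by exact_mod_cast hQ
    nlinarith
  have hscale : ∀ x : LocalRing L v, ((∏ w' : PlacesOver L v, normAbs (w'.1.adicCompletion L) ((α • x) w') : ℝ≥0) : ℝ) ^ 2 =
      ((distribHaarChar (LocalRing L v) α : ℝ) ^ 2) * (((∏ w' : PlacesOver L v, normAbs (w'.1.adicCompletion L) (x w') : ℝ≥0) : ℝ) ^ 2) := by
    intro x
    rw [show (α • x : LocalRing L v) = (α : LocalRing L v) * x from rfl, hmul, NNReal.coe_mul]; ring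
  have hposX : ∀ᵐ x ∂μX, 0 < ∏ w' : PlacesOver L v, normAbs (w'.1.adicCompletion L) (x w') := ae_prod_normAbs_pos L v w hw μX inferInstance
  have hposν : ∀ᵐ x ∂(μX.withDensity fun x => ((∏ w' : PlacesOver L v, normAbs (w'.1.adicCompletion L) (x w'))⁻¹ : ℝ≥0)),
      0 < ((∏ w' : PlacesOver L v, normAbs (w'.1.adicCompletion L) (x w') : ℝ≥0) : ℝ) ^ 2 :=
    withDensity_absolutelyContinuous μX _ (hposX.mono fun x hx => by positivity)
  have hdensm : Measurable (fun x : LocalRing L v => ((((∏ w' : PlacesOver L v, normAbs (w'.1.adicCompletion L) (x w'))⁻¹ : ℝ≥0)) : ℝ≥0∞)) :=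
    hnm.inv.coe_nnreal_ennreal
  have hν0 : (μX.withDensity fun x => ((∏ w' : PlacesOver L v, normAbs (w'.1.adicCompletion L) (x w'))⁻¹ : ℝ≥0)) ≠ 0 := by
    intro h0
    have h1 : ∫⁻ x, ((((∏ w' : PlacesOver L v, normAbs (w'.1.adicCompletion L) (x w'))⁻¹ : ℝ≥0)) : ℝ≥0∞) ∂μX = 0 := by
      rw [← setLIntegral_univ, ← withDensity_apply _ MeasurableSet.univ, h0, Measure.coe_zero, Pi.zero_apply]
    rw [lintegral_eq_zero_iff hdensm] at h1
    have h2 : ∀ᵐ x ∂μX, ((((∏ w' : PlacesOver L v, normAbs (w'.1.adicCompletion L) (x w'))⁻¹ : ℝ≥0)) : ℝ≥0∞) ≠ 0 := hposX.mono fun x hx => by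
      exact_mod_cast (inv_pos.2 hx).ne'
    have h3 : ∀ᵐ x ∂μX, False := (h1.and h2).mono fun x hx => hx.2 hx.1
    rw [Filter.eventually_false_iff_eq_bot, ae_eq_bot] at h3
    exact (isOpen_univ.measure_ne_zero μX Set.univ_nonempty) (by rw [h3]; rfl)
  exact F0P3cStCharTSHeightShellFundamentalDomain.measure_heightShell_ne_zero _ hQ21 hscale hposν hB₀
    (((NNReal.continuous_coe.measurable.comp hnm).pow_const 2) measurableSet_Ioc).nullMeasurableSet hν0

include hw in
/-- **`V < ∞`**: on the height shell the density `‖x‖⁻¹` is bounded by `Q/√B₀` and the shell lies in the compact ball `{‖x‖ ≤ √B₀}` (★ `isCompact_setOf_prod_normAbs_le`).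
[cite: WeilBNT1967, Ch. I §2] -/
theorem withDensity_heightShell_ne_top (α : (LocalRing L v)ˣ) {B₀ : ℝ} (hB₀ : 0 < B₀) :
    (μX.withDensity fun x => ((∏ w' : PlacesOver L v, normAbs (w'.1.adicCompletion L) (x w'))⁻¹ : ℝ≥0))
      ((fun x : LocalRing L v => ((∏ w' : PlacesOver L v, normAbs (w'.1.adicCompletion L) (x w') : ℝ≥0) : ℝ) ^ 2) ⁻¹'
        Set.Ioc (B₀ / ((distribHaarChar (LocalRing L v) α : ℝ) ^ 2)) B₀) ≠ ⊤ := by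
  have hnm := measurable_prod_normAbs L v
  set Q : ℝ := (distribHaarChar (LocalRing L v) α : ℝ) with hQdef
  have hQpos : 0 < Q := by rw [hQdef]; exact_mod_cast (distribHaarChar_pos : 0 < distribHaarChar (LocalRing L v) α)
  set T : Set (LocalRing L v) := (fun x : LocalRing L v => ((∏ w' : PlacesOver L v, normAbs (w'.1.adicCompletion L) (x w') : ℝ≥0) : ℝ) ^ 2) ⁻¹'
        Set.Ioc (B₀ / Q ^ 2) B₀ with hTdef
  have hT : MeasurableSet T := ((NNReal.continuous_coe.measurable.comp hnm).pow_const 2) measurableSet_Ioc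
  -- the shell lies in the compact ball `{‖x‖ ≤ √B₀}`
  have hsub : T ⊆ {x : LocalRing L v | ((∏ w' : PlacesOver L v, normAbs (w'.1.adicCompletion L) (x w') : ℝ≥0) : ℝ) ≤ Real.sqrt B₀} := by
    intro x hx
    have h2 : ((∏ w' : PlacesOver L v, normAbs (w'.1.adicCompletion L) (x w') : ℝ≥0) : ℝ) ^ 2 ≤ B₀ := hx.2
    have := Real.sqrt_le_sqrt h2
    rwa [Real.sqrt_sq (NNReal.coe_nonneg _)] at this
  have hfin : μX T < ⊤ := lt_of_le_of_lt (measure_mono hsub) (isCompact_setOf_prod_normAbs_le L v w hw (Real.sqrt B₀)).measure_lt_top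
  -- the density is bounded on the shell: `‖x‖² > B₀/Q²` gives `‖x‖⁻¹ ≤ (√(B₀/Q²))⁻¹`
  set C : ℝ≥0 := (NNReal.sqrt ⟨B₀ / Q ^ 2, (div_pos hB₀ (pow_pos hQpos 2)).le⟩)⁻¹ with hCdef
  have hbound : ∀ x ∈ T, ((((∏ w' : PlacesOver L v, normAbs (w'.1.adicCompletion L) (x w'))⁻¹ : ℝ≥0)) : ℝ≥0∞) ≤ (C : ℝ≥0∞) := by
    intro x hx
    have h1 : B₀ / Q ^ 2 < ((∏ w' : PlacesOver L v, normAbs (w'.1.adicCompletion L) (x w') : ℝ≥0) : ℝ) ^ 2 := hx.1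
    have hpos : 0 < B₀ / Q ^ 2 := div_pos hB₀ (pow_pos hQpos 2)
    have hle : NNReal.sqrt ⟨B₀ / Q ^ 2, hpos.le⟩ ≤ ∏ w' : PlacesOver L v, normAbs (w'.1.adicCompletion L) (x w') := by
      rw [NNReal.sqrt_le_iff_le_sq, ← NNReal.coe_le_coe, NNReal.coe_pow]
      exact h1.le
    have hspos : 0 < NNReal.sqrt ⟨B₀ / Q ^ 2, hpos.le⟩ := NNReal.sqrt_pos.2 (by exact_mod_cast hpos)
    exact ENNReal.coe_le_coe.2 (inv_anti₀ hspos hle)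
  rw [withDensity_apply _ hT]
  refine ne_of_lt (lt_of_le_of_lt (setLIntegral_mono measurable_const hbound) ?_)
  rw [setLIntegral_const]
  exact ENNReal.mul_lt_top ENNReal.coe_lt_top hfin

end ShellMass

/-! ## §3 The chart-annulus integral of `‖z‖⁻¹ h(z)` is a NON-ZERO constant times the skew-line integral `J_h` -/

section Slice

variable [MeasurableSpace (LocalRing L v)] [BorelSpace (LocalRing L v)] [Invertible (2 : LocalRing L v)]
  (μX : Measure (LocalRing L v)) [μX.IsAddHaarMeasure]
  (μY : Measure ↥(HeisRing.skewPart (conjLocal L (IsCMField.complexConj L) v))) [μY.IsAddHaarMeasure] [μY.Regular]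
  (D : LocalRing L v → ℂ)

include hw hns in
set_option maxHeartbeats 1600000 in
-- one `have` of ★ B3 with ~20 discharged binders, plus the a.e. twist
/-- **«CHART-ANNULUS INTEGRAL = K · J_h», `K ≠ 0`** (generic extension `D` of `χ₁(σ ·)⁻¹`: `D (b₀ b) = χ₁(σ b₀)⁻¹ • D b`, `D u = χ₁(σ u)⁻¹`, measurable, `‖D‖ ≤ 1`).  `v` non-split,
`χ₁` continuous and trivial on norms (`χ₁(σα · α) = 1`, NO hypothesis on `χ₁|_{F^×}`), `μX`, `μY` Haar measures of `R`, `R⁻`, `α` a unit with `Q = ‖α‖ > 1`.  There is `K ≠ 0` with,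
for every `A > 0`,  `∫ 𝟙_{(A/Q², A]}(‖z‖) · (‖z‖⁻¹ • D z) ∂(μX ⊗ μY) = K · ∫_{R⁻} ‖1+η‖⁻¹ • D(1+η) dμY`, `z = y − ½ x σx`
(§1: `D = c₀ h♯` on the chart, ★ B3 `integral_annulus_heisZ_eq_shellMass_smul_skewLineIntegral` on the fixed-unit invariant `h♯`, `h♯ = D` on `1 + R⁻`, §2 for `V`).
[cite: Keys1984, §5; §7 Thm. (1) p. 126] [cite: TateThesis1967, §2.2–2.4] [cite: WeilBNT1967, Ch. VII §2] -/
theorem exists_const_integral_annulus_heisZ_eq_mul_skewLineIntegral (h1 : Continuous fun x => ((χ₁ x : ℂˣ) : ℂ))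
    (hnorm : ∀ α : (LocalRing L v)ˣ, χ₁ (Units.map (conjLocal L (IsCMField.complexConj L) v : LocalRing L v →* LocalRing L v) α) * χ₁ α = 1)
    (hDmul : ∀ (b₀ : (LocalRing L v)ˣ) (b : LocalRing L v), D ((b₀ : LocalRing L v) * b) =
      (((χ₁ (Units.map (conjLocal L (IsCMField.complexConj L) v : LocalRing L v →* LocalRing L v) b₀))⁻¹ : ℂˣ) : ℂ) • D b)
    (hDunit : ∀ u : (LocalRing L v)ˣ, D (u : LocalRing L v) =
      (((χ₁ (Units.map (conjLocal L (IsCMField.complexConj L) v : LocalRing L v →* LocalRing L v) u))⁻¹ : ℂˣ) : ℂ))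
    (hDm : Measurable D) (hDb : ∀ b, ‖D b‖ ≤ 1)
    (α : (LocalRing L v)ˣ) (hQ : 1 < distribHaarChar (LocalRing L v) α) :
    ∃ K : ℂ, K ≠ 0 ∧ ∀ A : ℝ, 0 < A →
      ∫ p : LocalRing L v × ↥(HeisRing.skewPart (conjLocal L (IsCMField.complexConj L) v)),
          ((fun b : LocalRing L v => ((∏ w' : PlacesOver L v, normAbs (w'.1.adicCompletion L) (b w') : ℝ≥0) : ℝ)) ⁻¹'
              Set.Ioc (A / ((distribHaarChar (LocalRing L v) α : ℝ) ^ 2)) A).indicator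
            (fun b => ((∏ w' : PlacesOver L v, normAbs (w'.1.adicCompletion L) (b w'))⁻¹ : ℝ≥0) • D b)
            (heisZ (conjLocal L (IsCMField.complexConj L) v) p.1 (p.2 : LocalRing L v)) ∂(μX.prod μY) =
        K * ∫ η : ↥(HeisRing.skewPart (conjLocal L (IsCMField.complexConj L) v)),
          ((∏ w' : PlacesOver L v, normAbs (w'.1.adicCompletion L) ((1 + (η : LocalRing L v)) w'))⁻¹ : ℝ≥0) • D (1 + (η : LocalRing L v)) ∂μY := by
  haveI : SecondCountableTopology (LocalRing L v) := secondCountableTopology_localRing (E := L) v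
  have hσ := conjLocal_conjLocal_cm L v
  have hσc := continuous_conjLocal L (IsCMField.complexConj L) v
  haveI := HeisRing.locallyCompactSpace_skewPart (conjLocal L (IsCMField.complexConj L) v) hσc
  haveI : SecondCountableTopology ↥(HeisRing.skewPart (conjLocal L (IsCMField.complexConj L) v)) := TopologicalSpace.Subtype.secondCountableTopology _
  obtain ⟨δ, hδ⟩ := exists_conjLocal_skew_unit L v
  -- the constants: `c₀ = χ₁(−1) χ₁(2)⁻¹`, `c2i = (√‖½‖)⁻¹`, `V` the shell mass at `B₀ = 1`
  set c₀ : ℂ := ((χ₁ (-1) * (χ₁ (unitOfInvertible (2 : LocalRing L v)))⁻¹ : ℂˣ) : ℂ) with hc₀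
  have hc₀ne : c₀ ≠ 0 := Units.ne_zero _
  set V : ℝ := ((μX.withDensity fun x => ((∏ w' : PlacesOver L v, normAbs (w'.1.adicCompletion L) (x w'))⁻¹ : ℝ≥0))
      ((fun x : LocalRing L v => ((∏ w' : PlacesOver L v, normAbs (w'.1.adicCompletion L) (x w') : ℝ≥0) : ℝ) ^ 2) ⁻¹'
        Set.Ioc (1 / ((distribHaarChar (LocalRing L v) α : ℝ) ^ 2)) 1)).toReal with hV
  have hVne : V ≠ 0 := by
    rw [hV, Ne, ENNReal.toReal_eq_zero_iff, not_or]
    exact ⟨withDensity_heightShell_ne_zero L v w hw μX α hQ one_pos, withDensity_heightShell_ne_top L v w hw μX α one_pos⟩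
  set c2i : ℝ := ((NNReal.sqrt (∏ w' : PlacesOver L v, normAbs (w'.1.adicCompletion L) ((⅟(2 : LocalRing L v)) w')))⁻¹ : ℝ) with hc2i
  have hc2ine : c2i ≠ 0 := by
    rw [hc2i]
    have hpos : 0 < ∏ w' : PlacesOver L v, normAbs (w'.1.adicCompletion L) ((⅟(2 : LocalRing L v)) w') :=
      pos_iff_ne_zero.2 fun h => Invertible.ne_zero (⅟(2 : LocalRing L v)) ((prod_normAbs_eq_zero_iff L v w hw _).1 h)
    have : (0 : ℝ) < (NNReal.sqrt (∏ w' : PlacesOver L v, normAbs (w'.1.adicCompletion L) ((⅟(2 : LocalRing L v)) w')) : ℝ) := by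
      exact_mod_cast NNReal.sqrt_pos.2 hpos
    exact (inv_pos.2 this).ne'
  refine ⟨c₀ * ((c2i * V : ℝ) : ℂ), mul_ne_zero hc₀ne (by exact_mod_cast mul_ne_zero hc2ine hVne), fun A hA => ?_⟩
  -- (a) the a.e. twist `D(z) = c₀ h♯(z)` on the chart (for `μX`-a.e. `x`, a unit)
  have hunit : ∀ᵐ x ∂μX, IsUnit x := ae_isUnit L v w hw μX
  have hae : ∀ᵐ p : LocalRing L v × ↥(HeisRing.skewPart (conjLocal L (IsCMField.complexConj L) v)) ∂(μX.prod μY), IsUnit p.1 :=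
    (Measure.quasiMeasurePreserving_fst (μ := μX) (ν := μY)).ae hunit
  have hstep : ∫ p : LocalRing L v × ↥(HeisRing.skewPart (conjLocal L (IsCMField.complexConj L) v)),
      ((fun b : LocalRing L v => ((∏ w' : PlacesOver L v, normAbs (w'.1.adicCompletion L) (b w') : ℝ≥0) : ℝ)) ⁻¹'
          Set.Ioc (A / ((distribHaarChar (LocalRing L v) α : ℝ) ^ 2)) A).indicator
        (fun b => ((∏ w' : PlacesOver L v, normAbs (w'.1.adicCompletion L) (b w'))⁻¹ : ℝ≥0) • D b)
        (heisZ (conjLocal L (IsCMField.complexConj L) v) p.1 (p.2 : LocalRing L v)) ∂(μX.prod μY) =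
      c₀ * ∫ p : LocalRing L v × ↥(HeisRing.skewPart (conjLocal L (IsCMField.complexConj L) v)),
        ((fun b : LocalRing L v => ((∏ w' : PlacesOver L v, normAbs (w'.1.adicCompletion L) (b w') : ℝ≥0) : ℝ)) ⁻¹'
            Set.Ioc (A / ((distribHaarChar (LocalRing L v) α : ℝ) ^ 2)) A).indicator
          (fun b => ((∏ w' : PlacesOver L v, normAbs (w'.1.adicCompletion L) (b w'))⁻¹ : ℝ≥0) •
            (fun b : LocalRing L v => ((χ₁ (unitOfInvertible (2 : LocalRing L v)) : ℂˣ) : ℂ) * D b *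
              D (b + conjLocal L (IsCMField.complexConj L) v b)) b)
          (heisZ (conjLocal L (IsCMField.complexConj L) v) p.1 (p.2 : LocalRing L v)) ∂(μX.prod μY) := by
    rw [← integral_const_mul]
    refine integral_congr_ae (hae.mono fun p hp => ?_)
    by_cases hmem : heisZ (conjLocal L (IsCMField.complexConj L) v) p.1 (p.2 : LocalRing L v) ∈
        (fun b : LocalRing L v => ((∏ w' : PlacesOver L v, normAbs (w'.1.adicCompletion L) (b w') : ℝ≥0) : ℝ)) ⁻¹'
          Set.Ioc (A / ((distribHaarChar (LocalRing L v) α : ℝ) ^ 2)) A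
    · simp only [Set.indicator_of_mem hmem]
      conv_lhs => rw [apply_heisZ_eq_mul_hsharp L v χ₁ D hnorm hDunit hp p.2]
      rw [NNReal.smul_def, NNReal.smul_def, Complex.real_smul, Complex.real_smul]
      ring
    · simp only [Set.indicator_of_notMem hmem, mul_zero]
  -- (b) ★ B3 on `h♯`
  have hslice := F0P3cStCharTSHeisenbergAnnulusSlice.integral_annulus_heisZ_eq_shellMass_smul_skewLineIntegral (conjLocal L (IsCMField.complexConj L) v) hσ hσc
    μX μY (measurable_prod_normAbs L v) (prod_normAbs_units_mul L v) (prod_normAbs_one L v) (prod_normAbs_conjLocal L v w hw) δ hδ α hQ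
    (isUnit_one_add_coe_skewPart L v w hw) hunit hA (isCompact_setOf_prod_normAbs_heisZ_le L v w hw A) one_pos
    (fun b : LocalRing L v => ((χ₁ (unitOfInvertible (2 : LocalRing L v)) : ℂˣ) : ℂ) * D b * D (b + conjLocal L (IsCMField.complexConj L) v b))
    (measurable_hsharp L v χ₁ D hDm) (norm_hsharp_le_one L v hns χ₁ D h1 hnorm hDb) (hsharp_fixed_units_mul L v χ₁ D hnorm hDmul)
  -- (c) `h♯ = D` on `1 + R⁻`
  have hJ : ∫ η : ↥(HeisRing.skewPart (conjLocal L (IsCMField.complexConj L) v)),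
      ((∏ w' : PlacesOver L v, normAbs (w'.1.adicCompletion L) ((1 + (η : LocalRing L v)) w'))⁻¹ : ℝ≥0) •
        (fun b : LocalRing L v => ((χ₁ (unitOfInvertible (2 : LocalRing L v)) : ℂˣ) : ℂ) * D b *
          D (b + conjLocal L (IsCMField.complexConj L) v b)) (1 + (η : LocalRing L v)) ∂μY =
      ∫ η : ↥(HeisRing.skewPart (conjLocal L (IsCMField.complexConj L) v)),
        ((∏ w' : PlacesOver L v, normAbs (w'.1.adicCompletion L) ((1 + (η : LocalRing L v)) w'))⁻¹ : ℝ≥0) • D (1 + (η : LocalRing L v)) ∂μY :=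
    integral_congr_ae (Filter.Eventually.of_forall fun η => congrArg _ (hsharp_one_add L v χ₁ D hDunit η))
  rw [hstep, hslice, hJ, Complex.real_smul, ← mul_assoc]

open scoped Classical in
include hw hns in
set_option maxHeartbeats 1600000 in
/-- **The same for the extension by zero `h(b) = χ₁(σ b̂)⁻¹` of ★ B4's far-out integrand** (`D :=` the ★ `dite`; its two properties are ★ `dite_chiInvConj_units_mul`, ★ `dite_chiInvConj_apply_units`,
measurability ★ `measurable_dite_chiInvConj`, bound §1). [cite: Keys1984, §5; §7 Thm. (1) p. 126] [cite: TateThesis1967, §2.4] -/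
theorem exists_const_integral_annulus_heisZ_dite_eq_mul_skewLineIntegral (h1 : Continuous fun x => ((χ₁ x : ℂˣ) : ℂ))
    (hnorm : ∀ α : (LocalRing L v)ˣ, χ₁ (Units.map (conjLocal L (IsCMField.complexConj L) v : LocalRing L v →* LocalRing L v) α) * χ₁ α = 1)
    (α : (LocalRing L v)ˣ) (hQ : 1 < distribHaarChar (LocalRing L v) α) :
    ∃ K : ℂ, K ≠ 0 ∧ ∀ A : ℝ, 0 < A →
      ∫ p : LocalRing L v × ↥(HeisRing.skewPart (conjLocal L (IsCMField.complexConj L) v)),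
          ((fun b : LocalRing L v => ((∏ w' : PlacesOver L v, normAbs (w'.1.adicCompletion L) (b w') : ℝ≥0) : ℝ)) ⁻¹'
              Set.Ioc (A / ((distribHaarChar (LocalRing L v) α : ℝ) ^ 2)) A).indicator
            (fun b => ((∏ w' : PlacesOver L v, normAbs (w'.1.adicCompletion L) (b w'))⁻¹ : ℝ≥0) •
              (fun b : LocalRing L v => if hb : IsUnit b then
                (((χ₁ (Units.map (conjLocal L (IsCMField.complexConj L) v : LocalRing L v →* LocalRing L v) hb.unit))⁻¹ : ℂˣ) : ℂ) else 0) b)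
            (heisZ (conjLocal L (IsCMField.complexConj L) v) p.1 (p.2 : LocalRing L v)) ∂(μX.prod μY) =
        K * ∫ η : ↥(HeisRing.skewPart (conjLocal L (IsCMField.complexConj L) v)),
          ((∏ w' : PlacesOver L v, normAbs (w'.1.adicCompletion L) ((1 + (η : LocalRing L v)) w'))⁻¹ : ℝ≥0) •
            (fun b : LocalRing L v => if hb : IsUnit b then
                (((χ₁ (Units.map (conjLocal L (IsCMField.complexConj L) v : LocalRing L v →* LocalRing L v) hb.unit))⁻¹ : ℂˣ) : ℂ) else 0) (1 + (η : LocalRing L v)) ∂μY :=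
  exists_const_integral_annulus_heisZ_eq_mul_skewLineIntegral L v w hw hns χ₁ μX μY _ h1 hnorm
    (dite_chiInvConj_units_mul L v χ₁) (dite_chiInvConj_apply_units L v χ₁) (measurable_dite_chiInvConj L v w hw χ₁ h1)
    (norm_dite_le_one_of_conj_mul L v hns χ₁ h1 hnorm) α hQ

end Slice

end Summit.HodgeConjecture.HodgeConjecture.Cruxes.H413.K2E3IrregularReducibleCaseThreeSkewLineSlice

end
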